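import Summits.RiemannHypothesis.RiemannHypothesis.Theorems.SemilocalDeletionCliff
import Summits.RiemannHypothesis.RiemannHypothesis.Theorems.HandoffSemilocalEnergy
import Summits.RiemannHypothesis.RiemannHypothesis.Theorems.HandoffSliver
import HarnessLib

/-!
# The cliff floor is paid for on the SLIVERS: a confinement law for single-prime deletion

`SemilocalDeletionCliff.lean` (p362953): for `p ∈ S` prime and a test function `g` on `[−c, c]` with `c < L := log p`,
`Q_{S∖p}(g) = Q_S(g) + (L/√p)·(k(L) + k(−L))` (`k = g ⋆ g̃`), whence the CLIFF FLOOR `Re Q_{S∖p}(g) ≥ Re Q_S(g) − (L/√p)‖g‖₂²`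
via Bombieri's `|k(L) + k(−L)| ≤ ‖g‖₂²`.  But the lag-`L` autocorrelation only sees the two SLIVERS of the window that are a
distance `L` apart: the HANDOFF track's `norm_weilConv_weilReflect_add_neg_le_sliver` (HandoffSliver.lean) gives
`|k(L) + k(−L)| ≤ ∫_{[L−c, c]}|g|² + ∫_{[−c, c−L]}|g|²`.  So the floor is charged only on the sliver mass (§1):

* `re_weilSemilocalQuadratic_erase_ge_slivers` — **SLIVER FLOOR**:
  `Re Q_{S∖p}(g) ≥ Re Q_S(g) − (L/√p)·(∫_{[L−c, c]}|g|² + ∫_{[−c, c−L]}|g|²)`  (every finite `S ∋ p`, every `g ∈ C(c)`, `c < L`).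
  For `L/2 < c < L` the two slivers `[−c, c−L]`, `[L−c, c]` are disjoint outer zones of width `2c − L` (= twice the ROOM) and
  the mass in the CENTRAL zone `(c−L, L−c)` is not charged at all: it has no partner at distance `L` inside the window.

and, in the energy language of `HandoffSemilocalEnergy` (§2; `λ_min(S; c; P) = semilocalGroundEnergy S P c`):

* `offSliver_mass_le_excess` — **CONFINEMENT LAW**: for a unit `g ∈ C(c)` with `P g`,
  `(L/√p)·(1 − ∫_{[L−c,c]}|g|² − ∫_{[−c,c−L]}|g|²) ≤ Re Q_{S∖p}(g) − (λ_min(S; c; P) − L/√p)`: the mass a test function keeps OFF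
  the slivers is at most (its excess over the cliff floor)/(L/√p);
* `offSliver_mass_le_of_near_minimizer` — for an `η`-near-minimizer of the deleted form the off-sliver mass is at most
  `(λ_min(S∖p; c; P) − λ_min(S; c; P) + L/√p + η)/(L/√p)` = (EXCESS of the deleted bottom over its floor + η)/w_p.

This is the one-visible-power case of the fibre CONFINEMENT law of the Toeplitz line (`SemilocalDeletionToeplitzConfinement`,
several visible powers: leaked mass × certificate gap ≤ excess); here the «partial fibres» are the central zone and the gap is
the whole cliff `w_p = L/√p` (the smaller matrix is `A_0 = 0`).  DATA it is the theorem side of (lineage E, kit j217593,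
HOME/cc-s2-1/gen13/ANATOMY-LAW.md §5): at `b = 6/5` the deleted bottoms `U(6/5)∖{p}`, `p = 5, 7, 11` (one visible power, rooms
`0.395, 0.227, 0.001`) keep off-sliver mass fractions `θ` with `w_p·θ/EXCESS = 0.43 … 1.00` (`= 1.00` at room `0.001`: the window
barely sees `11`, the bottom sits at `λ_min(S) − 0` with all its mass central).  Nothing here bears on RH.
-/

set_option linter.dupNamespace false

noncomputable section

open Complex Filter Set MeasureTheory
open scoped Real Topology ComplexConjugate

namespace Summit.RiemannHypothesis.RiemannHypothesis.Theorems.SemilocalDeletionCliffConfinement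

open Literature.NumberTheory.LFunctions
open Summit.RiemannHypothesis.RiemannHypothesis.Theorems.SemilocalDeletionCliff
open Summit.RiemannHypothesis.RiemannHypothesis.Theorems.HandoffSemilocalEnergy
open Summit.RiemannHypothesis.RiemannHypothesis.Theorems.Handoff

variable {g : ℝ → ℂ} {S : Finset ℕ} {p : ℕ} {c : ℝ}

/-! ## §1  The sliver floor -/

/-- **SLIVER FLOOR of the deletion cliff.** For `p ∈ S` prime, `tsupport g ⊆ [−c, c]`, `c < log p`:
`Re Q_{S∖p}(g) ≥ Re Q_S(g) − (log p/√p)·(∫_{[log p − c, c]}|g|² + ∫_{[−c, c − log p]}|g|²)` — the cliff is charged on the two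
slivers at mutual distance `log p` only, not on the whole `‖g‖₂²`. -/
theorem re_weilSemilocalQuadratic_erase_ge_slivers (hg : IsWeilTest g) (hp : p.Prime) (hpS : p ∈ S)
    (hsupp : tsupport g ⊆ Icc (-c) c) (hcp : c < Real.log p) :
    (weilSemilocalQuadratic S g).re - Real.log p / Real.sqrt p *
        ((∫ u in Icc (Real.log p - c) c, ‖g u‖ ^ 2) + ∫ u in Icc (-c) (c - Real.log p), ‖g u‖ ^ 2) ≤
      (weilSemilocalQuadratic (S.erase p) g).re := by
  have h := weilSemilocalQuadratic_sub_erase hg hp hpS hsupp hcp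
  have hsl := norm_weilConv_weilReflect_add_neg_le_sliver hg hsupp (Real.log p)
  have hw : 0 ≤ Real.log p / Real.sqrt p :=
    div_nonneg (Real.log_nonneg (by exact_mod_cast hp.one_lt.le)) (Real.sqrt_nonneg _)
  have heq : (weilSemilocalQuadratic (S.erase p) g).re = (weilSemilocalQuadratic S g).re +
      Real.log p / Real.sqrt p *
        (weilConv g (weilReflect g) (Real.log p) + weilConv g (weilReflect g) (-Real.log p)).re := by
    have : weilSemilocalQuadratic (S.erase p) g = weilSemilocalQuadratic S g +
        ((Real.log p / Real.sqrt p : ℝ) : ℂ) *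
          (weilConv g (weilReflect g) (Real.log p) + weilConv g (weilReflect g) (-Real.log p)) := by
      linear_combination (-1 : ℂ) * h
    rw [this, Complex.add_re, Complex.re_ofReal_mul]
  rw [heq]
  have hre : -((∫ u in Icc (Real.log p - c) c, ‖g u‖ ^ 2) + ∫ u in Icc (-c) (c - Real.log p), ‖g u‖ ^ 2) ≤
      (weilConv g (weilReflect g) (Real.log p) + weilConv g (weilReflect g) (-Real.log p)).re := by
    have := (abs_re_le_norm _).trans hsl
    exact (abs_le.1 this).1
  nlinarith

/-- The sliver masses are nonnegative. -/
theorem sliver_mass_nonneg (g : ℝ → ℂ) (a b a' b' : ℝ) :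
    0 ≤ (∫ u in Icc a b, ‖g u‖ ^ 2) + ∫ u in Icc a' b', ‖g u‖ ^ 2 :=
  add_nonneg (setIntegral_nonneg measurableSet_Icc fun _ _ ↦ by positivity)
    (setIntegral_nonneg measurableSet_Icc fun _ _ ↦ by positivity)

/-- The sliver floor implies the cliff floor of `SemilocalDeletionCliff` as soon as the sliver mass is at most `‖g‖₂²`
(which is the case for `c < log p`, the slivers being disjoint parts of the window — recorded here in hypothesis form). -/
theorem re_weilSemilocalQuadratic_erase_ge_of_sliver_le (hg : IsWeilTest g) (hp : p.Prime) (hpS : p ∈ S)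
    (hsupp : tsupport g ⊆ Icc (-c) c) (hcp : c < Real.log p)
    (hle : (∫ u in Icc (Real.log p - c) c, ‖g u‖ ^ 2) + (∫ u in Icc (-c) (c - Real.log p), ‖g u‖ ^ 2) ≤
      ∫ u : ℝ, ‖g u‖ ^ 2) :
    (weilSemilocalQuadratic S g).re - Real.log p / Real.sqrt p * ∫ u : ℝ, ‖g u‖ ^ 2 ≤
      (weilSemilocalQuadratic (S.erase p) g).re := by
  have h := re_weilSemilocalQuadratic_erase_ge_slivers hg hp hpS hsupp hcp
  have hw : 0 ≤ Real.log p / Real.sqrt p :=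
    div_nonneg (Real.log_nonneg (by exact_mod_cast hp.one_lt.le)) (Real.sqrt_nonneg _)
  nlinarith

/-! ## §2  Confinement: near-floor functions live on the slivers -/

variable {P : (ℝ → ℂ) → Prop}

/-- **CONFINEMENT LAW (energy form).** For a unit test function `g ∈ C(c)` with `P g` and `c < log p`:
`(log p/√p)·(1 − sliver mass of g) ≤ Re Q_{S∖p}(g) − (λ_min(S; c; P) − log p/√p)`.  The left side is `w_p` times the mass `g`
keeps in the central zone `(c − log p, log p − c)` (off the two slivers); the right side is the excess of `g`'s deleted Rayleigh
quotient over the cliff floor.  Functions close to the floor are confined to the slivers. -/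
theorem offSliver_mass_le_excess (hg : IsWeilTest g) (hp : p.Prime) (hpS : p ∈ S)
    (hsupp : tsupport g ⊆ Icc (-c) c) (hcp : c < Real.log p) (hPg : P g) (hn : ∫ u : ℝ, ‖g u‖ ^ 2 = 1) :
    Real.log p / Real.sqrt p *
        (1 - ((∫ u in Icc (Real.log p - c) c, ‖g u‖ ^ 2) + ∫ u in Icc (-c) (c - Real.log p), ‖g u‖ ^ 2)) ≤
      (weilSemilocalQuadratic (S.erase p) g).re - (semilocalGroundEnergy S P c - Real.log p / Real.sqrt p) := by
  have h := re_weilSemilocalQuadratic_erase_ge_slivers hg hp hpS hsupp hcp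
  have h2 := semilocalGroundEnergy_le_re (S := S) hg hsupp hPg hn
  nlinarith

/-- **CONFINEMENT OF NEAR-MINIMIZERS.** If the unit test function `g ∈ C(c)` (`P g`, `c < log p`) is an `η`-near-minimizer of
the deleted form, `Re Q_{S∖p}(g) ≤ λ_min(S∖p; c; P) + η`, then
`(log p/√p)·(1 − sliver mass) ≤ (λ_min(S∖p; c; P) − λ_min(S; c; P) + log p/√p) + η`:
off-sliver mass × `w_p` ≤ EXCESS of the deleted bottom over the cliff floor, plus `η`. -/
theorem offSliver_mass_le_of_near_minimizer (hg : IsWeilTest g) (hp : p.Prime) (hpS : p ∈ S)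
    (hsupp : tsupport g ⊆ Icc (-c) c) (hcp : c < Real.log p) (hPg : P g) (hn : ∫ u : ℝ, ‖g u‖ ^ 2 = 1) {η : ℝ}
    (hnear : (weilSemilocalQuadratic (S.erase p) g).re ≤ semilocalGroundEnergy (S.erase p) P c + η) :
    Real.log p / Real.sqrt p *
        (1 - ((∫ u in Icc (Real.log p - c) c, ‖g u‖ ^ 2) + ∫ u in Icc (-c) (c - Real.log p), ‖g u‖ ^ 2)) ≤
      (semilocalGroundEnergy (S.erase p) P c - semilocalGroundEnergy S P c + Real.log p / Real.sqrt p) + η := by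
  have h := offSliver_mass_le_excess hg hp hpS hsupp hcp hPg hn
  linarith

/-- **Division form for an exact minimizer**: the off-sliver mass fraction is at most EXCESS/`w_p`. -/
theorem offSliver_mass_le_excess_div (hg : IsWeilTest g) (hp : p.Prime) (hpS : p ∈ S)
    (hsupp : tsupport g ⊆ Icc (-c) c) (hcp : c < Real.log p) (hPg : P g) (hn : ∫ u : ℝ, ‖g u‖ ^ 2 = 1)
    (hmin : (weilSemilocalQuadratic (S.erase p) g).re = semilocalGroundEnergy (S.erase p) P c) :
    1 - ((∫ u in Icc (Real.log p - c) c, ‖g u‖ ^ 2) + ∫ u in Icc (-c) (c - Real.log p), ‖g u‖ ^ 2) ≤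
      (semilocalGroundEnergy (S.erase p) P c - semilocalGroundEnergy S P c + Real.log p / Real.sqrt p) /
        (Real.log p / Real.sqrt p) := by
  have hw : 0 < Real.log p / Real.sqrt p :=
    div_pos (Real.log_pos (by exact_mod_cast hp.one_lt)) (Real.sqrt_pos.2 (by exact_mod_cast hp.pos))
  have h := offSliver_mass_le_of_near_minimizer hg hp hpS hsupp hcp hPg hn (η := 0) (by rw [hmin]; simp)
  rw [add_zero] at h
  rw [le_div_iff₀ hw, mul_comm]
  exact h

/-- **Under one rung.** If the undeleted form is nonnegative on the sphere (`0 ≤ λ_min(S; c; P)`, e.g. `S ⊇` all primes visible on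
`C(c)` and Weil positivity on `C(c)`), the off-sliver mass of a unit `g` is at most `(Re Q_{S∖p}(g) + log p/√p)/(log p/√p)`:
only functions whose deleted Rayleigh quotient is near `−log p/√p` — the cliff — must vacate the central zone. -/
theorem offSliver_mass_le_of_nonneg (hg : IsWeilTest g) (hp : p.Prime) (hpS : p ∈ S)
    (hsupp : tsupport g ⊆ Icc (-c) c) (hcp : c < Real.log p) (hPg : P g) (hn : ∫ u : ℝ, ‖g u‖ ^ 2 = 1)
    (hpos : 0 ≤ semilocalGroundEnergy S P c) :
    Real.log p / Real.sqrt p *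
        (1 - ((∫ u in Icc (Real.log p - c) c, ‖g u‖ ^ 2) + ∫ u in Icc (-c) (c - Real.log p), ‖g u‖ ^ 2)) ≤
      (weilSemilocalQuadratic (S.erase p) g).re + Real.log p / Real.sqrt p := by
  have h := offSliver_mass_le_excess hg hp hpS hsupp hcp hPg hn
  linarith

/-! ## §3  Several singly-visible primes (appended, cc-s2-1 gen13): the sliver floors ADD, each on its own slivers -/

/-- **MULTI-DELETION SLIVER FLOOR.** Let `T ⊆ S` consist of primes, each singly visible on the window: `c < log p` for every
`p ∈ T`.  Then `Re Q_{S∖T}(g) ≥ Re Q_S(g) − Σ_{p∈T} (log p/√p)·(∫_{[log p−c, c]}|g|² + ∫_{[−c, c−log p]}|g|²)`: deleting the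
family charges each prime only on ITS two slivers (which shrink as `log p` grows and are empty once `log p ≥ 2c`).
Sharper than the sum floor `−Σ_{p∈T} log p/√p·‖g‖₂²` of `SemilocalDeletionSchurFloor`/`…CliffMulti` wherever `g` has mass
in a central zone. -/
theorem re_weilSemilocalQuadratic_sdiff_ge_slivers (hg : IsWeilTest g) {T : Finset ℕ} (hTS : T ⊆ S)
    (hT : ∀ p ∈ T, p.Prime) (hsupp : tsupport g ⊆ Icc (-c) c) (hcT : ∀ p ∈ T, c < Real.log p) :
    (weilSemilocalQuadratic S g).re - ∑ p ∈ T, Real.log p / Real.sqrt p *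
        ((∫ u in Icc (Real.log p - c) c, ‖g u‖ ^ 2) + ∫ u in Icc (-c) (c - Real.log p), ‖g u‖ ^ 2) ≤
      (weilSemilocalQuadratic (S \ T) g).re := by
  induction T using Finset.induction_on with
  | empty => simp
  | @insert q T hqT ih =>
    have hqS : q ∈ S := hTS (Finset.mem_insert_self q T)
    have hTS' : T ⊆ S := (Finset.subset_insert q T).trans hTS
    have ih' := ih hTS' (fun p hp ↦ hT p (Finset.mem_insert_of_mem hp)) (fun p hp ↦ hcT p (Finset.mem_insert_of_mem hp))
    have hq : q.Prime := hT q (Finset.mem_insert_self q T)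
    have hcq : c < Real.log q := hcT q (Finset.mem_insert_self q T)
    have hqST : q ∈ S \ T := Finset.mem_sdiff.2 ⟨hqS, hqT⟩
    have hstep := re_weilSemilocalQuadratic_erase_ge_slivers (S := S \ T) hg hq hqST hsupp hcq
    rw [Finset.sdiff_insert, Finset.sum_insert hqT]
    linarith

/-- **MULTI-DELETION CONFINEMENT.** For a unit `g ∈ C(c)` with `P g` and `T ⊆ S` as above:
`Σ_{p∈T} (log p/√p)·(1 − sliver mass of g at distance log p) ≤ Re Q_{S∖T}(g) − (λ_min(S; c; P) − Σ_{p∈T} log p/√p)` —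
a function near the sum floor must sit on the slivers of EVERY deleted prime at once. -/
theorem sum_offSliver_mass_le_excess (hg : IsWeilTest g) {T : Finset ℕ} (hTS : T ⊆ S) (hT : ∀ p ∈ T, p.Prime)
    (hsupp : tsupport g ⊆ Icc (-c) c) (hcT : ∀ p ∈ T, c < Real.log p) (hPg : P g) (hn : ∫ u : ℝ, ‖g u‖ ^ 2 = 1) :
    ∑ p ∈ T, Real.log p / Real.sqrt p *
        (1 - ((∫ u in Icc (Real.log p - c) c, ‖g u‖ ^ 2) + ∫ u in Icc (-c) (c - Real.log p), ‖g u‖ ^ 2)) ≤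
      (weilSemilocalQuadratic (S \ T) g).re -
        (semilocalGroundEnergy S P c - ∑ p ∈ T, Real.log p / Real.sqrt p) := by
  have h := re_weilSemilocalQuadratic_sdiff_ge_slivers hg hTS hT hsupp hcT
  have h2 := semilocalGroundEnergy_le_re (S := S) hg hsupp hPg hn
  have hsplit : ∑ p ∈ T, Real.log p / Real.sqrt p *
      (1 - ((∫ u in Icc (Real.log p - c) c, ‖g u‖ ^ 2) + ∫ u in Icc (-c) (c - Real.log p), ‖g u‖ ^ 2)) =
      ∑ p ∈ T, Real.log p / Real.sqrt p - ∑ p ∈ T, Real.log p / Real.sqrt p *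
        ((∫ u in Icc (Real.log p - c) c, ‖g u‖ ^ 2) + ∫ u in Icc (-c) (c - Real.log p), ‖g u‖ ^ 2) := by
    rw [← Finset.sum_sub_distrib]
    refine Finset.sum_congr rfl fun p _ ↦ by ring
  rw [hsplit]
  linarith

end Summit.RiemannHypothesis.RiemannHypothesis.Theorems.SemilocalDeletionCliffConfinement

end
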